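import Summits.BirchSwinnertonDyer.BirchSwinnertonDyer.Theorems.PrintX10bReadoutIndexOfLocalClausesKS
import Summits.BirchSwinnertonDyer.BirchSwinnertonDyer.Theorems.PrintX10bStubReadoutLocalOff
import Summits.BirchSwinnertonDyer.BirchSwinnertonDyer.Theorems.PrintX10bStubReadoutLocalIndexP
import Summits.BirchSwinnertonDyer.BirchSwinnertonDyer.Theorems.PrintX10bStubReadoutLocalIndexBad
import Literature.NumberTheory.EllipticCurves.ZpExtensionEisensteinReadoutOrdinaryLocalKummerStrictProofs
import HarnessLib

/-!
# KS-TWINS of the three place-wise (B5) closers and of (B5): `stub_readoutLocalOffKS`, `stub_readoutLocalIndexPKS`,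
# `stub_readoutLocalIndexBadKS`, `stub_readoutIndexKS` (the leaf (CG) replaced by `Stmt.kummerStrictOnFrames`)
# (CG-FRAME (E), cell `pub/bsd-print-x9`; pen g14 «GO w3: CG-FRAME» 2026-08-29T00:29Z; seat bsd-line-x10b-p1 LEAD g10)

Summits-side, THEOREMS ONLY, ROUTE-INDEPENDENT (no `Theses` import). Proofs VERBATIM the originals — `stub_readoutLocalOff`
(x9-p2 g6, p676384; the leading binder is unused), `stub_readoutLocalIndexBad` (x10b-p2 LEAD g8, p676090; unused),
`stub_readoutLocalIndexP_of_principalShift` (x10b-p1-w7 g3, p679050/p679487) — with the ONE consumption of the leaf at `v ∣ p`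
replaced by the local-inclusion form of hS′, `exists_quotient_cocycle_principal_of_eisensteinTowerReadout_mem_selmerInfty_of_localKerOver_le`
(p682700), fed with `(hKS K W p κ v …).le`, `hKS : Stmt.kummerStrictOnFrames`; the frame facts (`K` imaginary quadratic,
`p ≠ 2`, `SatisfiesHeegnerHypothesis p K`, `κ` anticyclotomic, good ordinary `v ∣ p` ramified in `K_∞`) are the letter's own
binders / `Thm413Hypotheses`. Then `stub_readoutIndexKS := readoutIndexKS_of_localClauses …`. HONEST FRAMING: the
frame-restricted Kummer = strict statement is a HYPOTHESIS here; «beyond-print theorem»: no. BSD is not proved by any of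
this; no summit statement is proved by this seat.

References: [Howard2004HeegnerKolyvagin] Lemma 2.2.7 / Prop. 2.2.8, Lemma 3.2.7, proof of Thm. 2.2.10 (𝔮 = T^m + p);
[GreenbergLNM1716] §2–§4; [Brink2007] Thm. 2, Cor. 1; [MilneADT2006] I Cor. 2.3, Thm. 2.8; [SilvermanAEC2009] Prop. VII.4.1.
-/

set_option linter.dupNamespace false
set_option autoImplicit false

noncomputable section

open scoped Classical Pointwise ContRepresentation TensorProduct NumberField

open Function NumberField IsDedekindDomain Field
open Literature Literature.NumberTheory.EllipticCurves WeierstrassCurve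
open Literature.NumberTheory.GaloisCohomology Literature.NumberTheory.GaloisCohomology.Howard2004
open Literature.NumberTheory.GaloisRepresentations Literature.NumberTheory.GaloisRepresentations.DiscreteGaloisModule
open Literature.NumberTheory.EllipticCurves.GreenbergSelmer
open Summit.BirchSwinnertonDyer.BirchSwinnertonDyer.Theorems
open Literature.NumberTheory.EllipticCurves.ZpExtension (EisensteinLevel)

namespace Summit.BirchSwinnertonDyer.BirchSwinnertonDyer.Theorems.HeegnerMuPartControlGlue

/-! ## §1 (B5-OFF), KS-twin -/

/-- **KS-twin: letter (B5-OFF) `Stmt.readoutLocalOffKS` holds** («no contribution at the good places», `m₁ := 0`, `j₀ := 0`;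
proof verbatim `stub_readoutLocalOff` — the leading binder, now `Stmt.kummerStrictOnFrames`, is not used).
[cite: Howard2004HeegnerKolyvagin, Def. 2.1.10, Lemma 2.2.7 / Prop. 2.2.8 and proof of Thm. 2.2.10 (arXiv p. 17 L41–53)]
[cite: GreenbergLNM1716, §2 Prop. 2.1 and §4 pp. 107, 124] [cite: GreenbergVatsal2000, §2 p. 17] [cite: SilvermanAEC2009, Prop. VII.4.1] -/
theorem stub_readoutLocalOffKS : Stmt.readoutLocalOffKS := by
  intro _hKS N _ W _ K _ _ p _ κ γ jbar hyp _hCM _hirr _hirrK _hsc _hHp _hhK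
  haveI := hyp.isElliptic
  refine ⟨0, fun m hm _ ↦ ?_⟩
  letI := IwasawaAlgebra.isDomain_quotient_X_pow_add_C p hm
  letI := IwasawaAlgebra.isDiscreteValuationRing_quotient_X_pow_add_C p hm
  haveI := IwasawaAlgebra.EisensteinCoeff.isLocalRing_succ p hm
  letI := IwasawaAlgebra.EisensteinCoeff.algebraOfSpecSucc p m
  haveI := W.isScalarTower_algebraOfSpecSucc (K := K) (p := p) (m := m)
  letI := W.residueModuleSucc (K := K) (p := p) hm
  intro S hpS hbad _hSN _hSσ L hL hLS jbar' cd Dd fs hy hπ he hπX hek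
  refine ⟨0, fun j _ c hc v hvS ↦ ?_⟩
  have hpv : ((p : ℕ) : 𝓞 K) ∉ v.asIdeal := fun h ↦ hvS (hpS v h)
  -- `F ≤ condA F`: the `d = 0` term of the directed union
  unfold AdicTower.condA
  refine AddSubgroup.mem_iSup_of_mem 0 ?_
  rw [AddSubgroup.mem_comap]
  exact localization_mem_eisensteinSelmerStructure_of_eisensteinTowerReadout_mem_selmerInfty W κ hm _ _ hy.killed
    hy.ker_red hπ he hπX hek hyp.topGenerator S hbad v hvS hpv j c hc

/-! ## §2 (B5-BAD), KS-twin -/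

set_option maxHeartbeats 400000 in
set_option synthInstance.maxHeartbeats 80000 in
/-- **KS-twin: letter (B5-BAD) `Stmt.readoutLocalIndexBadKS` holds, with `Fv := ⊤`** (`c := 8 p^e`, `m₁ := 2 p^e + 1`, `j₀ := 0`;
proof verbatim `stub_readoutLocalIndexBad` — the leading binder is not used).
[cite: Howard2004HeegnerKolyvagin, Lemma 2.2.7 / Prop. 2.2.8 and proof of Thm. 2.2.10 (𝔮 = T^m + p)] [cite: MilneADT2006, I Thm. 2.8]
[cite: Brink2007, Thm. 2 and Cor. 1] -/
theorem stub_readoutLocalIndexBadKS : Stmt.readoutLocalIndexBadKS := by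
  intro _hKS N _ W _ K _ _ p _ κ γ jbar hyp _hCM _hirr _hirrK _hsc _hHp _hhK
  haveI := hyp.isElliptic
  have hN0 : N ≠ 0 := NeZero.ne N
  -- one exponent `e` for `κ⁻¹ = κ.unitTwist (-1)` over the places above `N` away from `p`
  have hdec : ∀ v : HeightOneSpectrum (𝓞 K), ((N : ℕ) : 𝓞 K) ∈ v.asIdeal → ((p : ℕ) : 𝓞 K) ∉ v.asIdeal →
      ¬ (GreenbergSelmer.decomp v ≤ κ.kerSubgroup) := fun v hNv hpv ↦
    ZpExtension.decomp_not_le_kerSubgroup_of_natCast_mem_of_satisfiesHeegnerHypothesis hyp.isImaginaryQuadratic κ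
      hyp.anticyclotomic hyp.heegner hN0 v hpv hNv
  obtain ⟨e, he⟩ := ZpExtension.exists_forall_toAdd_apply_absGaloisRestrict_eq_pow_of_natCast_mem κ hN0 hdec
  refine ⟨8 * p ^ e, 2 * p ^ e + 1, fun m hm hm₁ ↦ ?_⟩
  letI := IwasawaAlgebra.isDomain_quotient_X_pow_add_C p hm
  letI := IwasawaAlgebra.isDiscreteValuationRing_quotient_X_pow_add_C p hm
  haveI := IwasawaAlgebra.EisensteinCoeff.isLocalRing_succ p hm
  letI := IwasawaAlgebra.EisensteinCoeff.algebraOfSpecSucc p m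
  haveI := W.isScalarTower_algebraOfSpecSucc (K := K) (p := p) (m := m)
  letI := W.residueModuleSucc (K := K) (p := p) hm
  intro S hpS hbad hSN hSσ L hL hLS jbar' cd Dd fs hy hπ he' hπX hek
  refine ⟨0, fun j _ v hvS hpv ↦ ?_⟩
  obtain ⟨h, hh⟩ := he v ((hSN v hvS).resolve_left hpv) hpv
  have hh' : ((κ.unitTwist (-1)) (absGaloisRestrict K (v.adicCompletion K) h⁻¹)).toAdd = ((p ^ e : ℕ) : ℤ_[p]) := by
    rw [ZpExtension.unitTwist_apply, toAdd_ofAdd, map_inv, map_inv, toAdd_inv, hh, Units.val_neg, Units.val_one,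
      neg_one_mul, neg_neg]
  refine ⟨⊤, fun c _ ↦ AddSubgroup.mem_top _, ?_⟩
  exact W.finite_and_natCard_top_quotient_le_pow_eisensteinTower κ hm v hpv h⁻¹ (Nat.one_le_pow _ _ (Fact.out : p.Prime).pos)
    hh' (by omega) j _

/-! ## §3 (B5-P), KS-twin: the leaf consumption replaced by the local inclusion `localKerOver ≤ strictKer` -/

set_option maxHeartbeats 1600000 in
set_option synthInstance.maxHeartbeats 80000 in
/-- **KS-twin: letter (B5-P) `Stmt.readoutLocalIndexPKS` holds** (`c := 2 p^s`, `m₁ := p^s + 1`, `j₀ := 0`; proof verbatim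
`stub_readoutLocalIndexP_of_principalShift`, with the (hS′) input supplied by
`exists_quotient_cocycle_principal_of_eisensteinTowerReadout_mem_selmerInfty_of_localKerOver_le` over `(hKS K W_K p κ v …).le`,
`hKS : Stmt.kummerStrictOnFrames` — the frame facts at `v ∣ p` (good ordinary reduction, the ordinary point, ramification of `K_∞`)
from `Thm413Hypotheses`, `SatisfiesHeegnerHypothesis p K` from the letter).
[cite: Howard2004HeegnerKolyvagin, Lemma 2.2.7 / Prop. 2.2.8, Lemma 3.2.7 and proof of Thm. 2.2.10 (𝔮 = T^m + p)]
[cite: GreenbergLNM1716, §2–§3] [cite: Brink2007, Cor. 1] [cite: MilneADT2006, I Cor. 2.3] -/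
theorem stub_readoutLocalIndexPKS : Stmt.readoutLocalIndexPKS := by
  intro hKS N _ W _ K _ _ p _ κ γ jbar hyp _hCM _hirr _hirrK _hsc hHp _hhK
  haveI := hyp.isElliptic
  have hK : IsImaginaryQuadratic K := hyp.isImaginaryQuadratic
  -- every `v ∣ p` is finitely decomposed in `K_∞` (Brink), for `κ⁻¹ = κ.unitTwist (-1)`; one exponent `s` for all of them
  have hdec : ∀ v : HeightOneSpectrum (𝓞 K), ((p : ℕ) : 𝓞 K) ∈ v.asIdeal →
      ¬ (GreenbergSelmer.decomp v ≤ (κ.unitTwist (-1)).kerSubgroup) := fun v hpv ↦ by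
    rw [ZpExtension.kerSubgroup_unitTwist]
    exact ZpExtension.decomp_not_le_kerSubgroup_above_of_isAnticyclotomic_anyPrime K p hK κ hyp.anticyclotomic v hpv
  obtain ⟨s, hs⟩ := exists_forall_toAdd_apply_absGaloisRestrict_eq_pow_of_mem (κ.unitTwist (-1)) hdec
  -- the frame at `v ∣ p` from `Thm413Hypotheses` (stated before Howard's instance preamble): good reduction, `p ∤ a_v`,
  -- the ordinary point, ramification of `K_∞` at `v`
  have hgoodv : ∀ v : HeightOneSpectrum (𝓞 K), ((p : ℕ) : 𝓞 K) ∈ v.asIdeal → (W.baseChange K).HasGoodReductionAt v :=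
    fun v hpv ↦ W.hasGoodReductionAt_baseChange_of_hasGoodReductionAtPrime hyp.ordinary.1 v hpv
  have hurv : ∀ v : HeightOneSpectrum (𝓞 K), ((p : ℕ) : 𝓞 K) ∈ v.asIdeal → (W.baseChange K).HasUnitRootAt v := by
    intro v hpv
    rw [WeierstrassCurve.hasUnitRootAt_iff, WeierstrassCurve.ringChar_residueField_eq v (Fact.out : p.Prime) hpv]
    exact W.not_dvd_frobeniusTraceAt_baseChange_of_isOrdinaryAt hyp.ordinary v hpv
  have hordv : ∀ v : HeightOneSpectrum (𝓞 K), ((p : ℕ) : 𝓞 K) ∈ v.asIdeal →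
      ∃ P : localPoints (W.baseChange K) (v.adicCompletion K),
        (p : ℤ) • P = 0 ∧ P ∉ (W.baseChange K).localKernelOfReduction v :=
    fun v hpv ↦ (W.baseChange K).exists_ordinaryPoint_local_of_not_dvd_frobeniusTraceAt v (hgoodv v hpv) hpv
      (W.not_dvd_frobeniusTraceAt_baseChange_of_isOrdinaryAt hyp.ordinary v hpv)
  have hramv : ∀ v : HeightOneSpectrum (𝓞 K), ((p : ℕ) : 𝓞 K) ∈ v.asIdeal →
      ∃ 𝔓 ∈ v.primesAbove, ¬ 𝔓.inertia (absoluteGaloisGroup K) ≤ κ.kerSubgroup := fun v hpv ↦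
    ⟨adicCompletionPrime K v, adicCompletionPrime_mem_primesAbove K v,
      ZpExtension.inertia_not_le_kerSubgroup_of_isAnticyclotomic hK hyp.p_ne_two κ hyp.anticyclotomic hpv
        (adicCompletionPrime_mem_primesAbove K v)⟩
  refine ⟨2 * p ^ s, p ^ s + 1, fun m hm hm₁ ↦ ?_⟩
  letI := IwasawaAlgebra.isDomain_quotient_X_pow_add_C p hm
  letI := IwasawaAlgebra.isDiscreteValuationRing_quotient_X_pow_add_C p hm
  haveI := IwasawaAlgebra.EisensteinCoeff.isLocalRing_succ p hm
  letI := IwasawaAlgebra.EisensteinCoeff.algebraOfSpecSucc p m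
  haveI := W.isScalarTower_algebraOfSpecSucc (K := K) (p := p) (m := m)
  letI := W.residueModuleSucc (K := K) (p := p) hm
  intro S hpS hbad hSN hSσ L hL hLS jbar' cd Dd fs hy hπ he' hπX hek
  refine ⟨0, fun j _ v hvS hpv ↦ ?_⟩
  have hms : p ^ s < m := by omega
  obtain ⟨σ₀, hσ₀⟩ := hs v hpv
  -- the per-place statement on the setting's tower (`St.T = eisensteinTower`, `St.t_k.cond (inr v) = F_𝔮(v)_{k+1}` by `rfl`)
  refine readoutLocalIndexP_at W κ hm _ _ hy.killed hy.ker_red hπ he' hπX hek _ v hpv (hgoodv v hpv) (hordv v hpv) σ₀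
    hσ₀ hms j ?_ ?_
  · exact fun k ↦ (congrFun (W.eisensteinDVRSetting_t_cond (κ.unitTwist (-1)) hm S hpS hbad L hL hLS jbar' cd Dd fs k)
      (Sum.inr v)).trans (ZpExtension.eisensteinSelmerStructure_inr_of_mem _ _ _ _ _ _ _ hpv)
  · exact W.exists_quotient_cocycle_principal_of_eisensteinTowerReadout_mem_selmerInfty_of_localKerOver_le κ hm _ _
      hy.killed hy.ker_red hπ he' hπX hek hyp.topGenerator v hpv (hgoodv v hpv) (hordv v hpv)
      (hKS K W p κ v hK hyp.p_ne_two hHp hyp.anticyclotomic hpv (hgoodv v hpv) (hurv v hpv) (hramv v hpv)).le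

/-! ## §4 (B5), KS-twin -/

/-- **KS-twin: (B5) `stub_readoutIndexKS : Stmt.readoutIndexKS` holds** — the `m`-uniform index bound from the three place-wise
KS-letters (`readoutIndexKS_of_localClauses`). [cite: Howard2004HeegnerKolyvagin, Prop. 2.2.8 (second map) and proof of Thm. 2.2.10]
[cite: GreenbergLNM1716, Prop. 2.4 and §4 pp. 98, 104] -/
theorem stub_readoutIndexKS : Stmt.readoutIndexKS :=
  readoutIndexKS_of_localClauses stub_readoutLocalOffKS stub_readoutLocalIndexPKS stub_readoutLocalIndexBadKS

end Summit.BirchSwinnertonDyer.BirchSwinnertonDyer.Theorems.HeegnerMuPartControlGlue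

end
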